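import Mathlib.Data.Nat.Factorization.Induction
import Summits.KontsevichZagierPeriods.KontsevichZagierPeriods.Theorems.HurwitzMicroSectorsNormalFormPrincipleDlogMoves
import Summits.KontsevichZagierPeriods.KontsevichZagierPeriods.Theorems.HurwitzMicroSectorsNormalFormPrincipleSplitMoves

/-!
# `NormalFormPrinciple` (stmt-KontsevichZagierPeriods-3869), line `SketchIdeator1` — registered
# sub-goal `nf_pole_one`: a simple rational pole is in normal form (siege attempt k16)

Pure proof file (`--supports` the crux). The registered sub-goal `nf_pole_one` of the
split-denominator layer of the leaf `stub_boxRigidity`: the representation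
`T = [(0,1), c/(x − ρ)]` of a simple pole at a rational `ρ ∉ [0,1]` is congruent, modulo
`KZ.relations`, to the normal form "rational point + prime carriers"

  `[T] = [pt, r] + Σ_{p ∈ S} [(1,p), C_p / y]`,   `S` a finite set of primes, `r, C_p ∈ ℚ`.

The moves (all already in the tree, files `…DlogMoves.lean`, `…SplitMoves.lean`): one affine move
(rule 2) `x = ±y + ρ` onto a dlog representation `[(a, a+1), c'/y]` (`a = -ρ` or `a = ρ - 1`,
`0 < a`); one dilation by the denominator `D` of `a = A/D` (rule 2); one splitting at `A` (rule 1a):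
`[(A, A+D), c'/y] ≡ Λ(A+D, c') − Λ(A, c')` with the carriers `Λ(N, c) := [(1,N), c/y]`.

The **finite core** is the certificate of unique factorisation: for every finite set of primes
`S ⊇ primeFactors N`,

  `Λ(N, c) = Σ_{p ∈ S} v_p(N) • Λ(p, c)`   in `FormalRep ⧸ relations`

(`mk_carrier_eq_sum_factorization`, by `Nat.recOnMul` from `Λ(ab) = Λ(a) + Λ(b)`, itself one
splitting and one dilation), and additivity in `c` (rule 1b) turns the integer multiples into
coefficients: `z • Λ(p, c) = Λ(p, z c)`. The witnesses are explicit: `r = 0`,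
`S = primeFactors A ∪ primeFactors (A + D)`, `C_p = (v_p(A+D) − v_p(A)) · c'`.

Sources: M. Kontsevich, D. Zagier, *Periods* (2001), §1.1 (`log 2 = ∫₁² dx/x`), §1.2 rules (1), (2).
No definitions are introduced.
-/

noncomputable section

open MeasureTheory Set Finset
open Literature.NumberTheory.Transcendental Literature.NumberTheory.Transcendental.KZ

namespace Summit.KontsevichZagierPeriods.HurwitzMicroSectors.NormalFormPrinciple.PiBox

namespace Dlog

namespace NfPoleOneK16

/-! ## Classes in `FormalRep ⧸ relations` -/

/-- `x − y ∈ relations` gives equal classes. [folklore] -/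
theorem mk_eq_mk_of_sub_mem {x y : FormalRep} (h : x - y ∈ relations) :
    QuotientAddGroup.mk' relations x = QuotientAddGroup.mk' relations y := by
  rw [QuotientAddGroup.mk'_apply, QuotientAddGroup.mk'_apply, QuotientAddGroup.eq_iff_sub_mem]
  exact h

/-- A relation has class `0`. [folklore] -/
theorem mk_eq_zero_of_mem {x : FormalRep} (h : x ∈ relations) :
    QuotientAddGroup.mk' relations x = 0 := by
  rw [QuotientAddGroup.mk'_apply, QuotientAddGroup.eq_zero_iff]
  exact h

/-- `x − y − z ∈ relations` gives `[x] = [y] + [z]`. [folklore] -/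
theorem mk_eq_add_of_sub_sub_mem {x y z : FormalRep} (h : x - y - z ∈ relations) :
    QuotientAddGroup.mk' relations x =
      QuotientAddGroup.mk' relations y + QuotientAddGroup.mk' relations z := by
  rw [← map_add]
  exact mk_eq_mk_of_sub_mem (by rwa [← sub_sub])

/-! ## The carriers `Λ(N, c) = [(1,N), c/y]` and the finite core -/

section Carriers

variable {R : ℚ → ℚ → ℚ → IntegralRep 1}
  (hR : ∀ a b c, 0 < a → (R a b c).domain = {x | x 0 ∈ Set.Ioo (a:ℝ) b} ∧
    (R a b c).integrand = fun x => (c:ℝ) / x 0)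
include hR

/-- `Λ(1, c) = [(1,1), c/y]` is a relation (empty slab). [cite: KontsevichZagier2001, §1.2 rule (1)] -/
theorem mk_carrier_one (c : ℚ) : QuotientAddGroup.mk' relations (of (R 1 1 c)) = 0 :=
  mk_eq_zero_of_mem (slab_empty_mem_relations (R 1 1 c) (hR 1 1 c one_pos).1 le_rfl)

/-- **Multiplicativity of the carriers**: `Λ(ab, c) = Λ(a, c) + Λ(b, c)` for naturals `a, b ≥ 1`
— one splitting at `a` (rule 1a) and one dilation `y ↦ a y` of `[(1,b), c/y]` onto
`[(a, ab), c/y]` (rule 2). [cite: KontsevichZagier2001, §1.2 rules (1), (2)] -/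
theorem mk_carrier_mul {a b : ℕ} (ha : 1 ≤ a) (hb : 1 ≤ b) (c : ℚ) :
    QuotientAddGroup.mk' relations (of (R 1 ((a * b : ℕ) : ℚ) c)) =
      QuotientAddGroup.mk' relations (of (R 1 a c)) +
        QuotientAddGroup.mk' relations (of (R 1 b c)) := by
  have ha0 : (0:ℚ) < a := by exact_mod_cast ha
  -- splitting `(1, ab)` at `a`
  have h1 : of (R 1 ((a * b : ℕ) : ℚ) c) - of (R 1 a c) - of (R a ((a * b : ℕ) : ℚ) c) ∈
      relations := by
    refine split_mem_relations _ _ _ (hR 1 ((a * b : ℕ) : ℚ) c one_pos).1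
      (hR 1 (a:ℚ) c one_pos).1 (hR (a:ℚ) ((a * b : ℕ) : ℚ) c ha0).1 ?_ ?_ ?_ ?_
    · exact_mod_cast ha
    · exact_mod_cast Nat.le_mul_of_pos_right a (by omega)
    · intro x _
      rw [(hR 1 (a:ℚ) c one_pos).2, (hR 1 ((a * b : ℕ) : ℚ) c one_pos).2]
    · intro x _
      rw [(hR (a:ℚ) ((a * b : ℕ) : ℚ) c ha0).2, (hR 1 ((a * b : ℕ) : ℚ) c one_pos).2]
  -- dilation `(1, b) → (a, ab)`
  have h2 : of (R 1 b c) - of (R a ((a * b : ℕ) : ℚ) c) ∈ relations := by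
    refine dlog_scale_mem_relations (c := c) (s := (a:ℚ)) _ _ (hR 1 (b:ℚ) c one_pos).1 ?_ ?_ ?_
      one_pos ha0
    · rw [(hR (a:ℚ) ((a * b : ℕ) : ℚ) c ha0).1, mul_one, ← Nat.cast_mul]
    · intro x _
      rw [(hR 1 (b:ℚ) c one_pos).2]
    · intro x _
      rw [(hR (a:ℚ) ((a * b : ℕ) : ℚ) c ha0).2]
  rw [mk_eq_add_of_sub_sub_mem h1, ← mk_eq_mk_of_sub_mem h2]

/-- **The finite core (unique factorisation as a certificate)**: for `N ≠ 0` and every finite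
`S ⊇ primeFactors N`, `Λ(N, c) = Σ_{p ∈ S} v_p(N) • Λ(p, c)` in `FormalRep ⧸ relations`.
[cite: KontsevichZagier2001, §1.1] -/
theorem mk_carrier_eq_sum_factorization (c : ℚ) :
    ∀ N : ℕ, N ≠ 0 → ∀ S : Finset ℕ, N.primeFactors ⊆ S →
      QuotientAddGroup.mk' relations (of (R 1 N c)) =
        ∑ p ∈ S, N.factorization p • QuotientAddGroup.mk' relations (of (R 1 p c)) := by
  intro N
  induction N using Nat.recOnMul with
  | zero => exact fun h => absurd rfl h
  | one =>
    intro _ S _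
    simp only [Nat.factorization_one, Finsupp.coe_zero, Pi.zero_apply, zero_nsmul,
      Finset.sum_const_zero, Nat.cast_one]
    exact mk_carrier_one hR c
  | prime p hp =>
    intro _ S hS
    have hpS : p ∈ S := hS (Nat.mem_primeFactors.mpr ⟨hp, dvd_rfl, hp.ne_zero⟩)
    rw [Nat.Prime.factorization hp, Finset.sum_eq_single_of_mem p hpS fun q _ hq => by
      rw [Finsupp.single_eq_of_ne hq, zero_nsmul], Finsupp.single_eq_same, one_nsmul]
  | mul a b iha ihb =>
    intro hab S hS
    have ha : a ≠ 0 := left_ne_zero_of_mul hab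
    have hb : b ≠ 0 := right_ne_zero_of_mul hab
    rw [Nat.primeFactors_mul ha hb, Finset.union_subset_iff] at hS
    rw [Nat.factorization_mul ha hb, mk_carrier_mul hR (Nat.one_le_iff_ne_zero.mpr ha)
      (Nat.one_le_iff_ne_zero.mpr hb), iha ha S hS.1, ihb hb S hS.2, ← Finset.sum_add_distrib]
    refine Finset.sum_congr rfl fun p _ => ?_
    rw [Finsupp.coe_add, Pi.add_apply, add_nsmul]

/-- **Additivity in the coefficient** (rule 1b): `Λ_{(a,b)}(c + c') = Λ_{(a,b)}(c) + Λ_{(a,b)}(c')`.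
[cite: KontsevichZagier2001, §1.2 rule (1)] -/
theorem mk_carrier_add {a : ℚ} (ha : 0 < a) (b c c' : ℚ) :
    QuotientAddGroup.mk' relations (of (R a b (c + c'))) =
      QuotientAddGroup.mk' relations (of (R a b c)) +
        QuotientAddGroup.mk' relations (of (R a b c')) :=
  mk_eq_add_of_sub_sub_mem (dlog_merge_mem_relations _ _ _ (hR a b (c + c') ha).1
    (hR a b c ha).1 (hR a b c' ha).1 (fun x _ => by rw [(hR a b (c + c') ha).2])
    (fun x _ => by rw [(hR a b c ha).2]) (fun x _ => by rw [(hR a b c' ha).2]))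

/-- **Integer multiples become coefficients**: `Λ_{(a,b)}(z c) = z • Λ_{(a,b)}(c)` for `z ∈ ℤ`
(the coefficient map is additive, rule 1b). [cite: KontsevichZagier2001, §1.2 rule (1)] -/
theorem mk_carrier_zsmul {a : ℚ} (ha : 0 < a) (b c : ℚ) (z : ℤ) :
    QuotientAddGroup.mk' relations (of (R a b ((z:ℚ) * c))) =
      z • QuotientAddGroup.mk' relations (of (R a b c)) := by
  have h := map_zsmul (AddMonoidHom.mk' (fun c => QuotientAddGroup.mk' relations (of (R a b c)))
    fun c c' => mk_carrier_add hR ha b c c') z c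
  simpa only [AddMonoidHom.mk'_apply, zsmul_eq_mul] using h

/-! ## The affine move onto a dlog representation -/

/-- **The affine move** (rule 2): for a rational `ρ ∉ [0,1]` there are rationals `a > 0`, `c'` with
`[(0,1), c/(x−ρ)] = [(a, a+1), c'/y]` modulo relations (`x = y + ρ` if `ρ < 0`, `x = ρ − y` if
`ρ > 1`). [cite: KontsevichZagier2001, §1.2 rule (2)] -/
theorem exists_mk_pole_eq_mk_carrier {c ρ : ℚ} (hρ : (ρ:ℝ) ∉ Set.Icc (0:ℝ) 1) (T : IntegralRep 1)
    (hTd : T.domain = {x | x 0 ∈ Set.Ioo (0:ℝ) 1})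
    (hTi : EqOn T.integrand (fun x => (c:ℝ) / (x 0 - ρ)) T.domain) :
    ∃ a c' : ℚ, 0 < a ∧ QuotientAddGroup.mk' relations (of T) =
      QuotientAddGroup.mk' relations (of (R a (a + 1) c')) := by
  have hρ' : (ρ:ℝ) < 0 ∨ 1 < (ρ:ℝ) := by
    simpa only [Set.mem_Icc, not_and_or, not_le] using hρ
  rcases hρ' with hlt | hgt
  · -- `ρ < 0`: `x = y + ρ`, `a = -ρ`, `c' = c`
    have ha : (0:ℚ) < -ρ := by
      have : ρ < 0 := by exact_mod_cast hlt
      linarith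
    refine ⟨-ρ, c, ha, mk_eq_mk_of_sub_mem (affine_sub_mem_relations (s := 1) (t := -ρ)
      one_ne_zero T (R (-ρ) (-ρ + 1) c) (fun y => (c:ℝ) / y) ?_ ?_ ?_)⟩
    · rw [(hR (-ρ) (-ρ + 1) c ha).1, hTd,
        image_affine_slab_of_pos (by norm_num : (0:ℝ) < ((1:ℚ):ℝ))]
      have e1 : ((1:ℚ):ℝ) * 0 + ((-ρ : ℚ):ℝ) = ((-ρ : ℚ):ℝ) := by push_cast; ring
      have e2 : ((1:ℚ):ℝ) * 1 + ((-ρ : ℚ):ℝ) = ((-ρ + 1 : ℚ):ℝ) := by push_cast; ring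
      rw [e1, e2]
    · intro x _
      rw [(hR (-ρ) (-ρ + 1) c ha).2]
    · intro x hx
      rw [hTi hx]
      simp only [Rat.cast_one, Rat.cast_neg, one_mul, abs_one, mul_one, sub_eq_add_neg]
  · -- `1 < ρ`: `x = ρ - y`, `a = ρ - 1`, `c' = -c`
    have ha : (0:ℚ) < ρ - 1 := by
      have : 1 < ρ := by exact_mod_cast hgt
      linarith
    refine ⟨ρ - 1, -c, ha, mk_eq_mk_of_sub_mem (affine_sub_mem_relations (s := -1) (t := ρ)
      (by norm_num) T (R (ρ - 1) (ρ - 1 + 1) (-c)) (fun y => ((-c : ℚ):ℝ) / y) ?_ ?_ ?_)⟩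
    · rw [(hR (ρ - 1) (ρ - 1 + 1) (-c) ha).1, hTd,
        image_affine_slab_of_neg (by norm_num : ((-1:ℚ):ℝ) < 0)]
      have e1 : ((-1:ℚ):ℝ) * 1 + ((ρ : ℚ):ℝ) = ((ρ - 1 : ℚ):ℝ) := by push_cast; ring
      have e2 : ((-1:ℚ):ℝ) * 0 + ((ρ : ℚ):ℝ) = ((ρ - 1 + 1 : ℚ):ℝ) := by push_cast; ring
      rw [e1, e2]
    · intro x _
      rw [(hR (ρ - 1) (ρ - 1 + 1) (-c) ha).2]
    · intro x hx
      rw [hTi hx]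
      have e : (-1:ℝ) * x 0 + (ρ:ℝ) = -(x 0 - ρ) := by ring
      simp only [Rat.cast_neg, Rat.cast_one, abs_neg, abs_one, mul_one, neg_div]
      rw [e, div_neg, neg_neg]

end Carriers

/-- A positive rational is `A/D` with naturals `A, D ≥ 1`. [folklore] -/
theorem exists_nat_mul_eq {a : ℚ} (ha : 0 < a) : ∃ A D : ℕ, 1 ≤ A ∧ 1 ≤ D ∧ (D:ℚ) * a = A := by
  obtain ⟨A, hA⟩ := Int.eq_ofNat_of_zero_le (Rat.num_nonneg.mpr ha.le)
  refine ⟨A, a.den, ?_, a.den_pos, ?_⟩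
  · have h : (0:ℤ) < (A:ℤ) := hA ▸ Rat.num_pos.mpr ha
    exact_mod_cast h
  · rw [mul_comm, Rat.mul_den_eq_num, hA, Int.cast_natCast]

/-- **Registered sub-goal `nf_pole_one`** of crux stmt-KontsevichZagierPeriods-3869, line
`SketchIdeator1` (split-denominator layer of `stub_boxRigidity`): the simple rational pole
`[(0,1), c/(x − ρ)]`, `ρ ∉ [0,1]`, is in the normal form rational point + prime carriers,
`[T] = [pt, r] + Σ_{p ∈ S} [(1,p), C_p/y]` in `FormalRep ⧸ relations`, with the explicit certificate
`r = 0`, `S = primeFactors A ∪ primeFactors (A+D)`, `C_p = (v_p(A+D) − v_p(A)) c'` where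
`[T] = [(A/D, A/D + 1), c'/y]`. [cite: KontsevichZagier2001, §1.2 rules (1), (2)] -/
theorem nf_pole_one {R : ℚ → ℚ → ℚ → IntegralRep 1} {Z : ℚ → IntegralRep 0} (hR : ∀ a b c, 0 < a → (R a b c).domain = {x | x 0 ∈ Set.Ioo (a:ℝ) b} ∧ (R a b c).integrand = fun x => (c:ℝ) / x 0) (hZ : ∀ r, (Z r).domain = univ ∧ (Z r).integrand = fun _ => (r:ℝ)) {c ρ : ℚ} (hρ : (ρ:ℝ) ∉ Set.Icc (0:ℝ) 1) (T : IntegralRep 1) (hTd : T.domain = {x | x 0 ∈ Set.Ioo (0:ℝ) 1}) (hTi : EqOn T.integrand (fun x => (c:ℝ) / (x 0 - ρ)) T.domain) : ∃ (r : ℚ) (S : Finset ℕ) (C : ℕ → ℚ), (∀ p ∈ S, p.Prime) ∧ (∀ p, p ∉ S → C p = 0) ∧ QuotientAddGroup.mk' relations (of T) = QuotientAddGroup.mk' relations (of (Z r)) + ∑ p ∈ S, QuotientAddGroup.mk' relations (of (R 1 p (C p))) := by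
  -- (1) affine move onto a dlog representation `[(a, a+1), c'/y]`, `0 < a`
  obtain ⟨a, c', ha, h1⟩ := exists_mk_pole_eq_mk_carrier hR hρ T hTd hTi
  -- (2) `a = A / D`
  obtain ⟨A, D, hA, hD, hDa⟩ := exists_nat_mul_eq ha
  have hA0 : (0:ℚ) < A := by exact_mod_cast hA
  have hD0 : (0:ℚ) < D := by exact_mod_cast hD
  have hDa1 : (D:ℚ) * (a + 1) = ((A + D : ℕ) : ℚ) := by
    push_cast
    rw [mul_add, hDa, mul_one]
  -- (3) dilation by `D`: `[(a, a+1), c'/y] = [(A, A+D), c'/y]`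
  have h2 : QuotientAddGroup.mk' relations (of (R a (a + 1) c')) =
      QuotientAddGroup.mk' relations (of (R A ((A + D : ℕ) : ℚ) c')) := by
    refine mk_eq_mk_of_sub_mem (dlog_scale_mem_relations (c := c') (s := (D:ℚ)) _ _
      (hR a (a + 1) c' ha).1 ?_ ?_ ?_ ha hD0)
    · rw [(hR (A:ℚ) ((A + D : ℕ) : ℚ) c' hA0).1, hDa, hDa1]
    · intro x _
      rw [(hR a (a + 1) c' ha).2]
    · intro x _
      rw [(hR (A:ℚ) ((A + D : ℕ) : ℚ) c' hA0).2]
  -- (4) splitting at `A`: `Λ(A+D, c') = Λ(A, c') + [(A, A+D), c'/y]`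
  have h3 : QuotientAddGroup.mk' relations (of (R 1 ((A + D : ℕ) : ℚ) c')) =
      QuotientAddGroup.mk' relations (of (R 1 A c')) +
        QuotientAddGroup.mk' relations (of (R A ((A + D : ℕ) : ℚ) c')) := by
    refine mk_eq_add_of_sub_sub_mem (split_mem_relations _ _ _
      (hR 1 ((A + D : ℕ) : ℚ) c' one_pos).1 (hR 1 (A:ℚ) c' one_pos).1
      (hR (A:ℚ) ((A + D : ℕ) : ℚ) c' hA0).1 ?_ ?_ ?_ ?_)
    · exact_mod_cast hA
    · exact_mod_cast Nat.le_add_right A D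
    · intro x _
      rw [(hR 1 (A:ℚ) c' one_pos).2, (hR 1 ((A + D : ℕ) : ℚ) c' one_pos).2]
    · intro x _
      rw [(hR (A:ℚ) ((A + D : ℕ) : ℚ) c' hA0).2, (hR 1 ((A + D : ℕ) : ℚ) c' one_pos).2]
  -- (5) the finite core on `S = primeFactors A ∪ primeFactors (A + D)`
  set S : Finset ℕ := A.primeFactors ∪ (A + D).primeFactors with hS
  have h4 := mk_carrier_eq_sum_factorization hR c' A (by omega) S Finset.subset_union_left
  have h5 := mk_carrier_eq_sum_factorization hR c' (A + D) (by omega) S Finset.subset_union_right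
  -- (6) the certificate
  refine ⟨0, S, fun p => (((A + D).factorization p - A.factorization p : ℤ) : ℚ) * c',
    fun p hp => ?_, fun p hp => ?_, ?_⟩
  · rcases Finset.mem_union.mp hp with h | h <;> exact Nat.prime_of_mem_primeFactors h
  · rw [hS, Finset.mem_union, not_or, ← Nat.support_factorization, ← Nat.support_factorization,
      Finsupp.notMem_support_iff, Finsupp.notMem_support_iff] at hp
    simp [hp.1, hp.2]
  · have hZ0 : QuotientAddGroup.mk' relations (of (Z 0)) = 0 :=
      mk_eq_zero_of_mem (pt_zero_mem_relations (Z 0) (by rw [(hZ 0).2]; simp))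
    have h6 : QuotientAddGroup.mk' relations (of (R A ((A + D : ℕ) : ℚ) c')) =
        QuotientAddGroup.mk' relations (of (R 1 ((A + D : ℕ) : ℚ) c')) -
          QuotientAddGroup.mk' relations (of (R 1 A c')) := by
      rw [h3]; abel
    rw [hZ0, zero_add, h1, h2, h6, h4, h5, ← Finset.sum_sub_distrib]
    refine Finset.sum_congr rfl fun p _ => ?_
    rw [mk_carrier_zsmul hR one_pos, sub_smul, natCast_zsmul, natCast_zsmul]

end NfPoleOneK16

end Dlog

end Summit.KontsevichZagierPeriods.HurwitzMicroSectors.NormalFormPrinciple.PiBox
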